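import Summits.CriticalPhenomena.PercolationContinuityZ3.Theorems.PercPorousCriticalFiniteClusterVolumeTailSummitEquiv
import HarnessLib

/-!
# Forward ladder (G4 `ladder-down`) under the crux K = `FiniteClusterVolumeTail` (stmt-CriticalPhenomena-0943)

K (shared crux of PercPorousCritical / PercDebrisSweep / PercFoamCut / PercQuarantineIslands):
`∀ p, θ(p) > 0 → ∃ c > 0, ∀ m ≥ 1, P_p(m ≤ |C(0)| < ∞) ≤ exp(-c m^{2/3})`; `K ↔ PercolationContinuityZ3` is LANDED
(`finiteClusterVolumeTail_iff_percolationContinuityZ3`, p158843 / p153540).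

Graded family in K's OWN language, two parameters (density regime, stretched exponent):

* `RungAbove η`  — density regime `p > p_c(ℤ³)`, exponent `η`            (FLOOR: `η = 2/3` is Kesten–Zhang = Grimmett Thm (8.65));
* `RungEta   η`  — density regime `θ(p) > 0` (all percolating `p`), exponent `η` (TOP: `RungEta (2/3)` IS K, `Iff.rfl`).

Recorded here (all sorry-free):
* `rungEta_twoThirds_iff`      : `RungEta (2/3) ↔ K`                                  (top of the ladder = the crux verbatim);
* `rungAbove_of_le`            : `η ≤ 2/3 → RungAbove η`                              (the proved floor, every exponent);
* `rungEta_iff_criticalInstance`: `η ≤ 2/3 → (RungEta η ↔ its own p_c-instance)`     (the located GAP: the single point `p_c`);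
* `rungEta_of_summit`          : `η ≤ 2/3 → PercolationContinuityZ3 → RungEta η`      (S → Rung: each rung is a consequence of S);
* `gapEta_iff_jumpFat`         : `(RungEta η → K) ↔ JumpFat η`                        (the "rest of the way" is a jump-world negation);
* `jumpFat_twoThirds`          : `JumpFat (2/3)`                                       (PROVED negation-side floor, tree theorem);
* `jumpFat_mono`               : `η ≤ η' → JumpFat η → JumpFat η'`.

NOT filed as an item/line: see LADDER-FiniteClusterVolumeTail.md (critic: no same-density engine for any `RungEta η`, `η > 0`).
-/

noncomputable section

namespace Summit.CriticalPhenomena.PercolationContinuityZ3.Cruxes.FiniteClusterVolumeTail.FwdLadder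

open MeasureTheory
open Literature.Probability.Percolation Literature.Probability.LatticeModels
open Summit.CriticalPhenomena.PercolationContinuityZ3.Theses.PercPorousCritical (FiniteClusterVolumeTail)
open Summit.CriticalPhenomena.PercolationContinuityZ3.Theorems.FiniteClusterVolumeTail

/-- `TailLaw p η c`: at density `p`, `P_p(m ≤ |C(0)| < ∞) ≤ exp(-c·m^η)` for every `m ≥ 1`. -/
def TailLaw (p : unitInterval) (η c : ℝ) : Prop :=
  ∀ m : ℕ, 1 ≤ m →
    (bondPercolation (zdGraph 3) p).real
        {ω | (m : ℕ∞) ≤ (openCluster ω (0 : Site 3)).encard ∧ (openCluster ω (0 : Site 3)).Finite} ≤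
      Real.exp (-(c * (m : ℝ) ^ η))

/-- Density-restricted family (the FLOOR regime `p > p_c`): stretched-exponential finite-cluster tails with exponent `η`
at every strictly supercritical density. -/
def RungAbove (η : ℝ) : Prop :=
  ∀ p : unitInterval, criticalProb (zdGraph 3) (0 : Site 3) < (p : ℝ) → ∃ c : ℝ, 0 < c ∧ TailLaw p η c

/-- Same-density family (the crux's regime `θ(p) > 0`): exponent `η` at EVERY percolating density.
`RungEta (2/3)` is K verbatim; `RungEta η`, `0 < η < 2/3`, are the candidate rungs. -/
def RungEta (η : ℝ) : Prop :=
  ∀ p : unitInterval, 0 < theta (zdGraph 3) (0 : Site 3) p → ∃ c : ℝ, 0 < c ∧ TailLaw p η c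

/-- Jump-world negation of the `p_c`-instance of `RungEta η`: if `θ(p_c) > 0`, finite clusters at `p_c` are fatter than
`exp(-c m^η)` for every `c > 0`. -/
def JumpFat (η : ℝ) : Prop :=
  0 < theta (zdGraph 3) (0 : Site 3) (criticalProbI 3) → ¬ ∃ c : ℝ, 0 < c ∧ TailLaw (criticalProbI 3) η c

/-- TOP: the rung at `η = 2/3` is the crux, definitionally. -/
theorem rungEta_twoThirds_iff : RungEta ((2 : ℝ) / 3) ↔ FiniteClusterVolumeTail := Iff.rfl

/-- Monotonicity of the tail law in the exponent (`m ≥ 1`). -/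
theorem tailLaw_anti {p : unitInterval} {η η' c : ℝ} (hc : 0 ≤ c) (hη : η ≤ η') (h : TailLaw p η' c) :
    TailLaw p η c := by
  intro m hm
  refine (h m hm).trans (Real.exp_le_exp.mpr ?_)
  have hm1 : (1 : ℝ) ≤ (m : ℝ) := by exact_mod_cast hm
  have hpow : (m : ℝ) ^ η ≤ (m : ℝ) ^ η' := Real.rpow_le_rpow_of_exponent_le hm1 hη
  have := mul_le_mul_of_nonneg_left hpow hc
  linarith

theorem rungAbove_anti {η η' : ℝ} (hη : η ≤ η') (h : RungAbove η') : RungAbove η := fun p hp => by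
  obtain ⟨c, hc, hT⟩ := h p hp
  exact ⟨c, hc, tailLaw_anti hc.le hη hT⟩

theorem rungEta_anti {η η' : ℝ} (hη : η ≤ η') (h : RungEta η') : RungEta η := fun p hp => by
  obtain ⟨c, hc, hT⟩ := h p hp
  exact ⟨c, hc, tailLaw_anti hc.le hη hT⟩

theorem jumpFat_mono {η η' : ℝ} (hη : η ≤ η') (h : JumpFat η) : JumpFat η' := fun hθ ⟨c, hc, hT⟩ =>
  h hθ ⟨c, hc, tailLaw_anti hc.le hη hT⟩

/-- FLOOR (PROVED, Kesten–Zhang 1990 = Grimmett 1999 Thm (8.65), tree theorem `Grimmett1999_thm_8_65_holds.z3`). -/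
theorem rungAbove_twoThirds : RungAbove ((2 : ℝ) / 3) := fun p hp => Grimmett1999_thm_8_65_holds.z3 p hp

/-- FLOOR for every exponent `η ≤ 2/3`. -/
theorem rungAbove_of_le {η : ℝ} (hη : η ≤ (2 : ℝ) / 3) : RungAbove η := rungAbove_anti hη rungAbove_twoThirds

/-- THE LOCATED GAP: for `η ≤ 2/3` the whole content of `RungEta η` is its instance at the single density `p_c`. -/
theorem rungEta_iff_criticalInstance {η : ℝ} (hη : η ≤ (2 : ℝ) / 3) :
    RungEta η ↔
      (0 < theta (zdGraph 3) (0 : Site 3) (criticalProbI 3) → ∃ c : ℝ, 0 < c ∧ TailLaw (criticalProbI 3) η c) := by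
  constructor
  · exact fun h hθ => h _ hθ
  · intro h p hθ
    rcases (KestenZhang.criticalProb_le_of_theta_pos_zd hθ).eq_or_lt with heq | hlt
    · obtain rfl : p = criticalProbI 3 := Subtype.ext (by rw [coe_criticalProbI]; exact heq.symm)
      exact h hθ
    · exact rungAbove_of_le hη p hlt

/-- `S → Rung`: every rung `η ≤ 2/3` is a consequence of the conjunct (vacuous `p_c`-instance). -/
theorem rungEta_of_summit {η : ℝ} (hη : η ≤ (2 : ℝ) / 3) (hS : _root_.PercolationContinuityZ3) : RungEta η :=
  rungEta_anti hη (rungEta_twoThirds_iff.mpr (finiteClusterVolumeTail_of_percolationContinuityZ3 hS))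

/-- Negation-side FLOOR (PROVED, tree): in a jump world the `2/3`-law fails at `p_c`
(`not_kestenZhangTail_criticalProbI_of_theta_pos`: strip density + cheap blocking `u_m ≥ e^{-o(m²)}` + quarantine). -/
theorem jumpFat_twoThirds : JumpFat ((2 : ℝ) / 3) := fun hθ => not_kestenZhangTail_criticalProbI_of_theta_pos hθ

/-- "The rest of the way" from a rung to the crux is exactly the jump-world negation of the rung at `p_c`. -/
theorem gapEta_iff_jumpFat {η : ℝ} (hη : η ≤ (2 : ℝ) / 3) : (RungEta η → FiniteClusterVolumeTail) ↔ JumpFat η := by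
  constructor
  · intro hG hθ hT
    exact not_finiteClusterVolumeTail_of_theta_criticalProbI_pos hθ
      (hG ((rungEta_iff_criticalInstance hη).mpr fun _ => hT))
  · intro hJ hR
    by_cases h0 : theta (zdGraph 3) (0 : Site 3) (criticalProbI 3) = 0
    · exact finiteClusterVolumeTail_of_percolationContinuityZ3 (percolationContinuityZ3_iff.mpr h0)
    · have hθ : 0 < theta (zdGraph 3) (0 : Site 3) (criticalProbI 3) :=
        lt_of_le_of_ne measureReal_nonneg (Ne.symm h0)
      exact (hJ hθ (hR _ hθ)).elim

/-- Ladder composition (kernel-checked shape of the would-be line): a rung plus its jump-negation give the crux BY NAME. -/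
theorem finiteClusterVolumeTail_of_rung_of_jumpFat {η : ℝ} (hη : η ≤ (2 : ℝ) / 3)
    (hR : RungEta η) (hJ : JumpFat η) : FiniteClusterVolumeTail :=
  (gapEta_iff_jumpFat hη).mpr hJ hR

/-- … and a rung whose jump-negation is known is the conjunct itself (why no rung below `2/3` is filed while
`JumpFat η` is open, and why it becomes a restatement the day `JumpFat η` lands). -/
theorem rungEta_iff_summit_of_jumpFat {η : ℝ} (hη : η ≤ (2 : ℝ) / 3) (hJ : JumpFat η) :
    RungEta η ↔ _root_.PercolationContinuityZ3 :=
  ⟨fun hR => percolationContinuityZ3_of_finiteClusterVolumeTail (finiteClusterVolumeTail_of_rung_of_jumpFat hη hR hJ),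
   rungEta_of_summit hη⟩

end Summit.CriticalPhenomena.PercolationContinuityZ3.Cruxes.FiniteClusterVolumeTail.FwdLadder

end
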